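import Literature.Geometry.Lorentzian.ChartMetricCoord
import Literature.Geometry.Lorentzian.CurvatureNaturality
import Literature.Geometry.Lorentzian.IsometryProofs
import Literature.Geometry.Manifold.OpenSubmanifoldMFDeriv
import HarnessLib

/-!
# The Ricci tensor along an immersed chart is the coordinate Ricci of the pulled-back components

Bridge between the abstract Ricci tensor `g.ricci` of a smooth pseudo-Riemannian metric on a
manifold `M` (`LeviCivita.lean` / `Curvature.lean`) and the coordinate Ricci form
`MetricCoord.ricAt` (`CoordCurvature.lean`) of a field of components on a vector space, for an
**immersion of an open subset of the model space** `ψ : A → M`, `A ⊆ F` open, `dim F = dim M`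
(not necessarily a chart of `M`: the neck charts of `ε`-necks,
`Literature.Geometry.Riemannian.IsNeckChart` of `CkNecks.lean`, are such immersions of an annulus).
With the components `P(z)(v, w) = g_{ψ z}(dψ_z v, dψ_z w)` (`pullbackBilin ψ g.val z`, the tree's
`neckPullback g 1 ψ` up to packaging) we prove

* `ricci_immersedChart_eq_ricAt` — **`Ric^g_{ψ y}(dψ_y v, dψ_y w) = ricAt P y v w`** for `y ∈ A`:
  the pullback metric `ψ^* g` on the open submanifold `A` (`PseudoRiemannianMetric.comap` along
  `ψ ∘ Subtype.val`, smooth by `contMDiff_pullbackBilin_holds`, nondegenerate by injectivity of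
  `dψ`) has representative `P` (`val_comap_immersedChart`), so its Ricci tensor is `ricAt P`
  (`OpensChart.ricci_eq_ricAt`, O'Neill 1983, Lemma 3.52 in coordinates), and by naturality of
  the Ricci tensor under local isometries (`ricci_comap_apply`, O'Neill 1983, Prop. 3.59) it is
  also `Ric^g` on the pushed-forward vectors.

This is how curvature hypotheses on `(M, g)` are read in the conformal cylinder model of a neck
(R. Hamilton, Comm. Anal. Geom. 5 (1997), §C2; with `Lorentzian/CoordCylinderRicci.lean` for the
model's own Ricci tensor). Everything is proved; no definitions, no named facts.

## References

* B. O'Neill, *Semi-Riemannian geometry*, Academic Press 1983, Ch. 3, Lemma 3.52, Prop. 3.59.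
  [ONeill1983]
* R. S. Hamilton, *Four-manifolds with positive isotropic curvature*, Comm. Anal. Geom. 5 (1997),
  §C2, p. 31. [Hamilton1997]
-/

noncomputable section

set_option maxSynthPendingDepth 3

open Bundle Set Function Filter TopologicalSpace Manifold
open scoped Manifold ContDiff Topology

namespace Literature.Geometry.Lorentzian

section ImmersedChart

variable {E : Type*} [NormedAddCommGroup E] [NormedSpace ℝ E] {H : Type*} [TopologicalSpace H]
  {I : ModelWithCorners ℝ E H} {M : Type*} [TopologicalSpace M] [ChartedSpace H M]
  [IsManifold I ∞ M] [FiniteDimensional ℝ E] [CompleteSpace E]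
  {F : Type*} [NormedAddCommGroup F] [NormedSpace ℝ F] [FiniteDimensional ℝ F] [CompleteSpace F]
  (g : PseudoRiemannianMetric I ∞ E (TangentSpace I : M → Type _))
  {A : Opens F} {ψ : F → M}

omit [IsManifold I ∞ M] [FiniteDimensional ℝ E] [CompleteSpace E] [FiniteDimensional ℝ F]
  [CompleteSpace F] in
/-- The immersion restricted to the open submanifold `A` is `C^{∞+1} = C^∞`. [folklore] -/
theorem contMDiff_immersedChart_comp_val (hψ : ContMDiffOn 𝓘(ℝ, F) I ∞ ψ A) :
    ContMDiff 𝓘(ℝ, F) I (∞ + 1) (ψ ∘ (Subtype.val : A → F)) := by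
  have h : ((∞ : ℕ∞ω) + 1) = ∞ := rfl
  rw [h]
  exact hψ.comp_contMDiff contMDiff_subtype_val fun y ↦ y.2

omit [IsManifold I ∞ M] [FiniteDimensional ℝ E] [CompleteSpace E] [FiniteDimensional ℝ F]
  [CompleteSpace F] in
/-- The differential of `ψ ∘ Subtype.val` at `y : A` is the differential of `ψ` at `↑y`
(the inclusion of the open submanifold has identity differential,
`OpenSubmanifold.mfderiv_subtype_val`). [folklore] -/
theorem mfderiv_immersedChart_comp_val_apply (hψ : ContMDiffOn 𝓘(ℝ, F) I ∞ ψ A) (y : A) (v : F) :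
    mfderiv 𝓘(ℝ, F) I (ψ ∘ (Subtype.val : A → F)) y v = mfderiv 𝓘(ℝ, F) I ψ y.1 v := by
  have hd : MDifferentiableAt 𝓘(ℝ, F) I ψ y.1 :=
    ((hψ y.1 y.2).contMDiffAt (A.2.mem_nhds y.2)).mdifferentiableAt (by simp)
  have hchain := mfderiv_comp y hd
    (Literature.Geometry.Manifold.OpenSubmanifold.mdifferentiableAt_subtype_val y)
  rw [hchain, Literature.Geometry.Manifold.OpenSubmanifold.mfderiv_subtype_val]
  rfl

omit [IsManifold I ∞ M] [FiniteDimensional ℝ E] [CompleteSpace E] [FiniteDimensional ℝ F]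
  [CompleteSpace F] in
/-- The differential of `ψ ∘ Subtype.val` is injective where that of `ψ` is. [folklore] -/
theorem injective_mfderiv_immersedChart_comp_val (hψ : ContMDiffOn 𝓘(ℝ, F) I ∞ ψ A)
    (hψ' : ∀ z ∈ A, Function.Injective (mfderiv 𝓘(ℝ, F) I ψ z)) (y : A) :
    Function.Injective (mfderiv 𝓘(ℝ, F) I (ψ ∘ (Subtype.val : A → F)) y) := by
  intro v w h
  have h' : mfderiv 𝓘(ℝ, F) I ψ y.1 v = mfderiv 𝓘(ℝ, F) I ψ y.1 w := by
    rw [← mfderiv_immersedChart_comp_val_apply hψ y v, ← mfderiv_immersedChart_comp_val_apply hψ y w]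
    exact h
  exact hψ' y.1 y.2 h'

omit [CompleteSpace E] [CompleteSpace F] in
/-- **The representative of the pullback metric on the open submanifold is the pulled-back
component field** `P(z) = (ψ^* g)_z`: `(Φ^* g)_y = P(↑y)` for `Φ = ψ ∘ Subtype.val`.
[cite: ONeill1983, Ch. 3, Def. 3.9 and p. 58] -/
theorem val_comap_immersedChart (hψ : ContMDiffOn 𝓘(ℝ, F) I ∞ ψ A)
    (hψ' : ∀ z ∈ A, Function.Injective (mfderiv 𝓘(ℝ, F) I ψ z))
    (hdim : Module.finrank ℝ F = Module.finrank ℝ E) (y : A) :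
    (g.comap PseudoRiemannianMetric.contMDiff_pullbackBilin_holds (ψ ∘ (Subtype.val : A → F))
        (contMDiff_immersedChart_comp_val hψ) (injective_mfderiv_immersedChart_comp_val hψ hψ')
        hdim).val y =
      pullbackBilin (I := I) (I' := 𝓘(ℝ, F)) ψ g.val y.1 := by
  rw [PseudoRiemannianMetric.val_comap]
  ext v w
  change g.val ((ψ ∘ Subtype.val) y) (mfderiv 𝓘(ℝ, F) I (ψ ∘ (Subtype.val : A → F)) y v)
      (mfderiv 𝓘(ℝ, F) I (ψ ∘ (Subtype.val : A → F)) y w) =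
    g.val (ψ y.1) (mfderiv 𝓘(ℝ, F) I ψ y.1 v) (mfderiv 𝓘(ℝ, F) I ψ y.1 w)
  have hvw : ((mfderiv 𝓘(ℝ, F) I (ψ ∘ (Subtype.val : A → F)) y v : E),
      (mfderiv 𝓘(ℝ, F) I (ψ ∘ (Subtype.val : A → F)) y w : E)) =
      ((mfderiv 𝓘(ℝ, F) I ψ y.1 v : E), (mfderiv 𝓘(ℝ, F) I ψ y.1 w : E)) := by
    rw [mfderiv_immersedChart_comp_val_apply hψ y v, mfderiv_immersedChart_comp_val_apply hψ y w]
    rfl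
  exact congrArg (fun p : E × E ↦ g.val (ψ y.1) p.1 p.2) hvw

/-- **The Ricci tensor along an immersed chart is the coordinate Ricci of the pulled-back
components**: for a smooth metric `g` on `M` (with its Levi-Civita connection), an immersion
`ψ` of the open set `A ⊆ F` into `M`, `dim F = dim M`, and `y ∈ A`,
`Ric^g_{ψ y}(dψ_y v, dψ_y w) = ricAt (z ↦ (ψ^*g)_z) y v w` — naturality of `Ric` under the local
isometry `(A, ψ^*g) → (M, g)` (`ricci_comap_apply`) and the coordinate expression of the Ricci
tensor of a metric on an open subset of a vector space (`OpensChart.ricci_eq_ricAt`).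
[cite: ONeill1983, Ch. 3, Prop. 3.59 and Lemma 3.52] -/
theorem ricci_immersedChart_eq_ricAt [g.HasLeviCivita] (hψ : ContMDiffOn 𝓘(ℝ, F) I ∞ ψ A)
    (hψ' : ∀ z ∈ A, Function.Injective (mfderiv 𝓘(ℝ, F) I ψ z))
    (hdim : Module.finrank ℝ F = Module.finrank ℝ E) (y : A) (v w : F) :
    g.ricci (ψ y.1) (mfderiv 𝓘(ℝ, F) I ψ y.1 v) (mfderiv 𝓘(ℝ, F) I ψ y.1 w) =
      MetricCoord.ricAt (fun z : F ↦ pullbackBilin (I := I) (I' := 𝓘(ℝ, F)) ψ g.val z) y.1 v w := by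
  set g' := g.comap PseudoRiemannianMetric.contMDiff_pullbackBilin_holds
    (ψ ∘ (Subtype.val : A → F)) (contMDiff_immersedChart_comp_val hψ)
    (injective_mfderiv_immersedChart_comp_val hψ hψ') hdim with hg'
  haveI := g'.hasLeviCivita
  have hrepr : ∀ z : A, g'.val z = (fun z : F ↦ pullbackBilin (I := I) (I' := 𝓘(ℝ, F)) ψ g.val z) z :=
    fun z ↦ val_comap_immersedChart g hψ hψ' hdim z
  have h1 : g'.ricci y v w =
      MetricCoord.ricAt (fun z : F ↦ pullbackBilin (I := I) (I' := 𝓘(ℝ, F)) ψ g.val z) y.1 v w :=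
    OpensChart.ricci_eq_ricAt hrepr y v w
  have h2 : g'.ricci y v w = g.ricci ((ψ ∘ (Subtype.val : A → F)) y)
      (mfderiv 𝓘(ℝ, F) I (ψ ∘ (Subtype.val : A → F)) y v)
      (mfderiv 𝓘(ℝ, F) I (ψ ∘ (Subtype.val : A → F)) y w) :=
    g.ricci_comap_apply PseudoRiemannianMetric.contMDiff_pullbackBilin_holds
      (contMDiff_immersedChart_comp_val hψ) (injective_mfderiv_immersedChart_comp_val hψ hψ') hdim
      y v w
  have hvw : ((mfderiv 𝓘(ℝ, F) I ψ y.1 v : E), (mfderiv 𝓘(ℝ, F) I ψ y.1 w : E)) =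
      ((mfderiv 𝓘(ℝ, F) I (ψ ∘ (Subtype.val : A → F)) y v : E),
        (mfderiv 𝓘(ℝ, F) I (ψ ∘ (Subtype.val : A → F)) y w : E)) := by
    rw [mfderiv_immersedChart_comp_val_apply hψ y v, mfderiv_immersedChart_comp_val_apply hψ y w]
    rfl
  calc g.ricci (ψ y.1) (mfderiv 𝓘(ℝ, F) I ψ y.1 v) (mfderiv 𝓘(ℝ, F) I ψ y.1 w)
      = g.ricci ((ψ ∘ (Subtype.val : A → F)) y)
          (mfderiv 𝓘(ℝ, F) I (ψ ∘ (Subtype.val : A → F)) y v)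
          (mfderiv 𝓘(ℝ, F) I (ψ ∘ (Subtype.val : A → F)) y w) :=
        congrArg (fun p : E × E ↦ g.ricci (ψ y.1) p.1 p.2) hvw
    _ = g'.ricci y v w := h2.symm
    _ = _ := h1

/-- The same identity at a point `z ∈ A` given as an element of `F`. [cite: ONeill1983, Ch. 3, Prop. 3.59 and Lemma 3.52] -/
theorem ricci_immersedChart_eq_ricAt' [g.HasLeviCivita] (hψ : ContMDiffOn 𝓘(ℝ, F) I ∞ ψ A)
    (hψ' : ∀ z ∈ A, Function.Injective (mfderiv 𝓘(ℝ, F) I ψ z))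
    (hdim : Module.finrank ℝ F = Module.finrank ℝ E) {z : F} (hz : z ∈ A) (v w : F) :
    g.ricci (ψ z) (mfderiv 𝓘(ℝ, F) I ψ z v) (mfderiv 𝓘(ℝ, F) I ψ z w) =
      MetricCoord.ricAt (fun z : F ↦ pullbackBilin (I := I) (I' := 𝓘(ℝ, F)) ψ g.val z) z v w :=
  ricci_immersedChart_eq_ricAt g hψ hψ' hdim ⟨z, hz⟩ v w

omit [CompleteSpace E] [CompleteSpace F] in
/-- **The pulled-back components are metric components on `A`** in the sense of the coordinate
calculus (`MetricCoord.IsMetricOn`: smooth, symmetric, nondegenerate on the open set `A`) — so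
that all the coordinate identities and estimates of `CoordCurvature.lean` ff. apply to them.
[cite: ONeill1983, Ch. 3, Def. 3.1] -/
theorem isMetricOn_pullbackBilin_immersedChart (hψ : ContMDiffOn 𝓘(ℝ, F) I ∞ ψ A)
    (hψ' : ∀ z ∈ A, Function.Injective (mfderiv 𝓘(ℝ, F) I ψ z))
    (hdim : Module.finrank ℝ F = Module.finrank ℝ E) :
    MetricCoord.IsMetricOn (fun z : F ↦ pullbackBilin (I := I) (I' := 𝓘(ℝ, F)) ψ g.val z)
      (A : Set F) :=
  OpensChart.isMetricOn_repr (fun z ↦ val_comap_immersedChart g hψ hψ' hdim z)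

end ImmersedChart

end Literature.Geometry.Lorentzian

end
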